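import Summits.FinalStateConjecture.FinalStateConjecture.Theorems.BulkKerrCapture.Negative.SpinGapAndMass
import Literature.Geometry.Lorentzian.LeviCivitaProofs
import Literature.Geometry.Lorentzian.KerrDataSchwarzschildConstraints

/-!
# `BulkKerrCapture` (stmt-FinalStateConjecture-10696, route PhaseMixingCapture) — negative-side
# lemmas III: every degenerate centre in one lemma, the Levi-Civita hypothesis discharged, and the
# complete classification of the family `BulkCaptureFamily T P`

Refuter seat `refuter-cdisprove-stmt-FinalStateConjecture-10696-g2-0` (standing disprover of the
crux, cycle 2), 2026-08-16; workfile `Cruxes/BulkKerrCapture/Disproof.lean` §3b. Nothing here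
closes the item; these are kernel-checked NEGATIVE LEMMAS (cdisprove protocol (a)–(c)) that
sharpen `SpinGapAndMass.lean` (cycle 1) in three ways.

* `captureAt_noMGHD_of_not_isSubextremal` — if the conclusion block `CaptureAt s δ k M hM ε C a`
  holds with some `ε > 0` at a centre `Kerr.data M a M` whose own parameters are NOT sub-extremal
  (`M ≤ |a|`: extremal, super-extremal, or massless `M = a = 0`), then that exact Kerr datum has NO
  maximal vacuum Cauchy development (the modulus pins `(M', a') = (M, a)`, required sub-extremal).
  The Levi-Civita hypothesis of cycle 1 is DISCHARGED by `PseudoRiemannianMetric.hasLeviCivita`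
  (`LeviCivitaProofs`, O'Neill 1983, Thm. 3.11, proved in the tree); only the vacuum constraints of
  that one datum remain as hypothesis (named fact `Kerr.data_isVacuumConstraintSolution M a M`).
* `bulkCaptureFamily_false_of_one_le`, `bulkCaptureFamily_false_of_mass_zero` — the general
  `(T, P)` forms of cycle 1's two kills (threshold set reaching `a₁ ≥ 1` with an admissible `M > 0`;
  admissible `M = 0` with `T ≠ ∅`), without `hLC`, and with the constraint hypothesis cut down to
  what is used: the massless kill needs NO constraint fact any more (the `a = 0` constraints are
  the tree theorem `Kerr.data_isVacuumConstraintSolution_zero`, here at `M = 0`), the extremal kill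
  only the constraints of the extremal slice data `Kerr.data M M M`; MGHD existence
  (Choquet-Bruhat–Geroch, `choquetBruhat_geroch_exists_mghd_cauchy`) is used only at the
  degenerate datum (`exists_mghd_kerrData_of`, `exists_mghd_kerrData_zero`). The instance binders
  `[Kerr.Facts] [Kerr.SliceFacts]` cost little: `Kerr.Facts` is a tree theorem
  (`SwallowTheDatum.kerrFacts`) and `Kerr.SliceFacts` reduces to its two unproved fields
  `Kerr.sliceK_symm`, `Kerr.contMDiff_sliceK` (sister file
  `NearExtremalKappaCapture/Negative/ExponentMonotonicity.lean`, `sliceFacts_of`).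
* `bulkCaptureFamily_classification` — modulo those named facts EVERY member of the family is
  (i) vacuous (`T = ∅` or no admissible mass `M ≥ 0`; trivially true, `bulkCaptureFamily_of_vacuous`),
  (ii) inside the envelope `T ⊆ Iio 1 ∧ ¬ P 0` (implied by the crux,
  `bulkCaptureFamily_of_bulkKerrCapture`), or (iii) false (modulo CBG and, for the extremal centre
  only, the constraints of `Kerr.data M M M`). The crux `(Iio 1, (0 < ·))` is the
  largest member of class (ii): its side conditions `a₁ < 1`, `0 < M` are exactly the boundary of
  degenerate-centre refutability, so no further negative information can be extracted from the
  quantifier prefix on this side — any refutation of the crux itself needs genuinely non-Kerr data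
  in the ball.

## References

* Y. Choquet-Bruhat, R. Geroch, Comm. Math. Phys. 14 (1969) 329–335, Thm. 3 (MGHD existence).
* B. O'Neill, *Semi-Riemannian geometry*, Academic Press 1983, Ch. 3, Thm. 3.11 (Levi-Civita).
* P. Hintz, arXiv:2606.28253, Thm. 13.1 and Rem. 13.2 (the sub-extremal range `|a₀| < m₀`; the
  inner radius `r = m₀` must lie in `(r⁻, r⁺)` — exactly what fails at the degenerate centres).
-/

-- the problem namespace `FinalStateConjecture.FinalStateConjecture` (single-conjunct summit) trips dupNamespace
set_option linter.dupNamespace false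

noncomputable section

open Set
open scoped Manifold ENNReal ContDiff

namespace Summit.FinalStateConjecture.FinalStateConjecture.Theorems.BulkKerrCapture.Negative

open Literature.Geometry.Lorentzian
open Summit.FinalStateConjecture.FinalStateConjecture.Theses.PhaseMixingCapture (BulkKerrCapture)

/-- **Core degenerate-centre lemma.** If `CaptureAt s δ k M hM ε C a` holds with `ε > 0` at a
centre whose parameters are not sub-extremal (`¬ |a| < M`), then the exact Kerr datum
`Kerr.data M a M` (which lies in every ball around itself, `dist_self = 0`) has no maximal vacuum
Cauchy development: for such a `𝒟` the conclusion would give sub-extremal `(M', a')` with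
`|M' − M| + |a' − a| ≤ C · √0 = 0`. Only the vacuum constraints for that one datum are assumed
(`hvac`); the Levi-Civita instance is `PseudoRiemannianMetric.hasLeviCivita`. [folklore] -/
theorem captureAt_noMGHD_of_not_isSubextremal [Kerr.Facts] [Kerr.SliceFacts] {s : ℕ} {δ : ℝ}
    {k : ℕ} {M : ℝ} {hM : 0 ≤ M} {ε C a : ℝ} (hε : 0 < ε) (ha : ¬ Kerr.IsSubextremal M a)
    (h : CaptureAt s δ k M hM ε C a) (hvac : Kerr.data_isVacuumConstraintSolution M a M)
    (𝒟 : VacuumCauchyDevelopment (Kerr.data M a M hM)) : ¬ 𝒟.IsMaximal := by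
  intro hmax
  haveI := (Kerr.data M a M hM).metric.hasLeviCivita
  have h0 : InitialDataSet.dataWeightedSobolevEDist s δ (Kerr.data M a M hM)
      (Kerr.data M a M hM) < ENNReal.ofReal ε := by
    rw [InitialDataSet.dataWeightedSobolevEDist_self]
    exact ENNReal.ofReal_pos.2 hε
  obtain ⟨M', a', -, hsub, -, -, hpar⟩ := h _ (hvac hM) h0 𝒟 hmax
  rw [InitialDataSet.dataWeightedSobolevEDist_self, ENNReal.toReal_zero, Real.sqrt_zero,
    mul_zero] at hpar
  have h1 : |M' - M| ≤ 0 := by linarith [abs_nonneg (a' - a)]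
  have h2 : |a' - a| ≤ 0 := by linarith [abs_nonneg (M' - M)]
  have hM' : M' = M := by linarith [abs_le.1 h1]
  have ha' : a' = a := by linarith [abs_le.1 h2]
  subst hM' ha'
  exact ha hsub

/-- The degenerate regimes of the core lemma: extremal (`|a| = M`), super-extremal (`M < |a|`)
and massless (`M = 0`, any `a`) centres are not sub-extremal. [folklore] -/
theorem not_isSubextremal_of_le {M a : ℝ} (h : M ≤ |a|) : ¬ Kerr.IsSubextremal M a := by
  unfold Kerr.IsSubextremal
  exact not_lt.2 h

/-- MGHD existence for ONE Kerr datum from its constraint fact and Choquet-Bruhat–Geroch, without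
the Levi-Civita hypothesis of cycle 1 (`exists_mghd_kerrData`): the instance is
`PseudoRiemannianMetric.hasLeviCivita`. [cite: ChoquetBruhatGeroch1969CMP, Thm. 3 (p. 332)] -/
theorem exists_mghd_kerrData_of [Kerr.Facts] [Kerr.SliceFacts] {M a r₀ : ℝ}
    (hvac : Kerr.data_isVacuumConstraintSolution M a r₀)
    (hMGHD : choquetBruhat_geroch_exists_mghd_cauchy) (hM : 0 ≤ M) :
    ∃ 𝒟 : VacuumCauchyDevelopment (Kerr.data M a r₀ hM), 𝒟.IsMaximal := by
  haveI := (Kerr.data M a r₀ hM).metric.hasLeviCivita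
  exact hMGHD (Kerr.slice a r₀) (Kerr.data M a r₀ hM) (hvac hM)

/-- MGHD existence for the Schwarzschild / flat members `a = 0` modulo Choquet-Bruhat–Geroch
ALONE: their constraints are the tree theorem `Kerr.data_isVacuumConstraintSolution_zero`.
[cite: ChoquetBruhatGeroch1969CMP, Thm. 3 (p. 332)] -/
theorem exists_mghd_kerrData_zero [Kerr.Facts] [Kerr.SliceFacts]
    (hMGHD : choquetBruhat_geroch_exists_mghd_cauchy) (M r₀ : ℝ) (hM : 0 ≤ M) :
    ∃ 𝒟 : VacuumCauchyDevelopment (Kerr.data M 0 r₀ hM), 𝒟.IsMaximal :=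
  exists_mghd_kerrData_of (Kerr.data_isVacuumConstraintSolution_zero M r₀) hMGHD hM

/-- **(A, general form.)** Every member whose threshold set reaches some `a₁ ≥ 1` and whose mass
predicate admits some `M > 0` is FALSE modulo Choquet-Bruhat–Geroch and the constraints of the
extremal slice data `Kerr.data M M M` (`hvac`, named fact `Kerr.data_isVacuumConstraintSolution`
at `a = M`, `r₀ = M`; unproved in the tree for `a ≠ 0`): the extremal centre `a = M`
(`|M| ≤ a₁ M`) has an MGHD by CBG and none by `captureAt_noMGHD_of_not_isSubextremal`.
Specialises to cycle 1's `bulkCaptureFamily_false_without_spinGap` (`T = Iic 1`, `M = 1`), now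
without `hLC`. [folklore] -/
theorem bulkCaptureFamily_false_of_one_le [Kerr.Facts] [Kerr.SliceFacts] {T : Set ℝ}
    {P : ℝ → Prop} (hT : ∃ a₁ ∈ T, 1 ≤ a₁) (hP : ∃ M, 0 < M ∧ P M)
    (hvac : ∀ M : ℝ, Kerr.data_isVacuumConstraintSolution M M M)
    (hMGHD : choquetBruhat_geroch_exists_mghd_cauchy) : ¬ BulkCaptureFamily T P := by
  intro h
  obtain ⟨a₁, ha₁T, ha₁⟩ := hT
  obtain ⟨M, hM, hPM⟩ := hP
  obtain ⟨s, δ, k, hk⟩ := h a₁ ha₁T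
  obtain ⟨ε, hε, C, hC⟩ := hk M hM.le hPM
  have hspin : |M| ≤ a₁ * M := by
    rw [abs_of_pos hM]
    nlinarith
  obtain ⟨𝒟, hmax⟩ := exists_mghd_kerrData_of (hvac M) hMGHD hM.le
  exact captureAt_noMGHD_of_not_isSubextremal hε
    (not_isSubextremal_of_le (by rw [abs_of_pos hM])) (hC M hspin) (hvac M) 𝒟 hmax

/-- **(B, general form.)** Every member with nonempty threshold set whose mass predicate admits
`M = 0` is FALSE modulo Choquet-Bruhat–Geroch ALONE: the massless centre `M = a = 0` (flat
punctured data, `|0| ≤ a₁ · 0`; its constraints are the tree theorem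
`Kerr.data_isVacuumConstraintSolution_zero 0 0`) has an MGHD by CBG and none by the core lemma.
Specialises to cycle 1's `bulkCaptureFamily_false_without_posMass` (`T = Iio 1`, `P = ⊤`), now
without `hLC` and without `hvac`. [folklore] -/
theorem bulkCaptureFamily_false_of_mass_zero [Kerr.Facts] [Kerr.SliceFacts] {T : Set ℝ}
    {P : ℝ → Prop} (hT : T.Nonempty) (hP : P 0)
    (hMGHD : choquetBruhat_geroch_exists_mghd_cauchy) : ¬ BulkCaptureFamily T P := by
  intro h
  obtain ⟨a₁, ha₁⟩ := hT
  obtain ⟨s, δ, k, hk⟩ := h a₁ ha₁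
  obtain ⟨ε, hε, C, hC⟩ := hk 0 le_rfl hP
  have hspin : |(0 : ℝ)| ≤ a₁ * 0 := by simp
  obtain ⟨𝒟, hmax⟩ := exists_mghd_kerrData_zero hMGHD 0 0 le_rfl
  exact captureAt_noMGHD_of_not_isSubextremal hε (not_isSubextremal_of_le (by simp))
    (hC 0 hspin) (Kerr.data_isVacuumConstraintSolution_zero 0 0) 𝒟 hmax

/-- **The crux implies every member inside the envelope** `T ⊆ Iio 1`, `¬ P 0` (admissible masses
`M ≥ 0` with `P M` are then positive). [folklore] -/
theorem bulkCaptureFamily_of_bulkKerrCapture (h : BulkKerrCapture) [Kerr.Facts] [Kerr.SliceFacts]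
    {T : Set ℝ} {P : ℝ → Prop} (hT : T ⊆ Iio 1) (hP : ¬ P 0) : BulkCaptureFamily T P := by
  intro a₁ ha₁
  obtain ⟨s, δ, k, hk⟩ := (bulkKerrCapture_iff_family.1 h) a₁ (hT ha₁)
  refine ⟨s, δ, k, fun M hM hPM ↦ hk M hM (lt_of_le_of_ne hM ?_)⟩
  rintro rfl
  exact hP hPM

/-- Vacuous members hold trivially: empty threshold set, or no admissible mass `M ≥ 0`.
[folklore] -/
theorem bulkCaptureFamily_of_vacuous [Kerr.Facts] [Kerr.SliceFacts] {T : Set ℝ} {P : ℝ → Prop}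
    (h : T = ∅ ∨ ∀ M, 0 ≤ M → ¬ P M) : BulkCaptureFamily T P := by
  intro a₁ ha₁
  rcases h with rfl | hP
  · exact (Set.notMem_empty a₁ ha₁).elim
  · exact ⟨0, 0, 0, fun M hM hPM ↦ (hP M hM hPM).elim⟩

/-- **Classification of the family `BulkCaptureFamily T P`.** Modulo the named facts (vacuum
constraints of the Kerr data, Choquet-Bruhat–Geroch), every member falls in exactly one of three
explicit classes: (i) VACUOUS (`T = ∅` or no admissible mass `M ≥ 0`) — trivially true;
(ii) inside the ENVELOPE (`T ⊆ Iio 1`, `¬ P 0`) — implied by the crux; (iii) outside it — FALSE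
(by the extremal centre `a = M` if some `a₁ ≥ 1` and some `M > 0` are admissible, by the massless
centre if `P 0`). The crux `(Iio 1, (0 < ·))` is the largest member of class (ii): its two side
conditions are precisely the boundary of degenerate-centre refutability. [folklore] -/
theorem bulkCaptureFamily_classification [Kerr.Facts] [Kerr.SliceFacts]
    (hvac : ∀ M : ℝ, Kerr.data_isVacuumConstraintSolution M M M)
    (hMGHD : choquetBruhat_geroch_exists_mghd_cauchy) (T : Set ℝ) (P : ℝ → Prop) :
    ((T = ∅ ∨ ∀ M, 0 ≤ M → ¬ P M) ∧ BulkCaptureFamily T P) ∨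
      ((T ⊆ Iio 1 ∧ ¬ P 0) ∧ (BulkKerrCapture → BulkCaptureFamily T P)) ∨
      ((T.Nonempty ∧ ((∃ a₁ ∈ T, 1 ≤ a₁) ∧ (∃ M, 0 < M ∧ P M) ∨ P 0)) ∧
        ¬ BulkCaptureFamily T P) := by
  by_cases hvacuous : T = ∅ ∨ ∀ M, 0 ≤ M → ¬ P M
  · exact Or.inl ⟨hvacuous, bulkCaptureFamily_of_vacuous hvacuous⟩
  push Not at hvacuous
  obtain ⟨hT, M, hM, hPM⟩ := hvacuous
  by_cases hP0 : P 0
  · exact Or.inr (Or.inr ⟨⟨hT, Or.inr hP0⟩,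
      bulkCaptureFamily_false_of_mass_zero hT hP0 hMGHD⟩)
  have hMpos : 0 < M := lt_of_le_of_ne hM (by rintro rfl; exact hP0 hPM)
  by_cases hone : ∃ a₁ ∈ T, 1 ≤ a₁
  · exact Or.inr (Or.inr ⟨⟨hT, Or.inl ⟨hone, M, hMpos, hPM⟩⟩,
      bulkCaptureFamily_false_of_one_le hone ⟨M, hMpos, hPM⟩ hvac hMGHD⟩)
  · push Not at hone
    exact Or.inr (Or.inl ⟨⟨fun a₁ ha₁ ↦ hone a₁ ha₁, hP0⟩,
      fun h ↦ bulkCaptureFamily_of_bulkKerrCapture h (fun a₁ ha₁ ↦ hone a₁ ha₁) hP0⟩)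

/-- **The two cycle-1 kills, without the Levi-Civita hypothesis** (corollary of the general
forms; compare `strengthenings_fail`). [folklore] -/
theorem strengthenings_fail' [Kerr.Facts] [Kerr.SliceFacts]
    (hvac : ∀ M : ℝ, Kerr.data_isVacuumConstraintSolution M M M)
    (hMGHD : choquetBruhat_geroch_exists_mghd_cauchy) :
    ¬ BulkCaptureFamily (Iic 1) (fun M ↦ 0 < M) ∧ ¬ BulkCaptureFamily (Iio 1) (fun _ ↦ True) :=
  ⟨bulkCaptureFamily_false_of_one_le ⟨1, Set.mem_Iic.2 le_rfl, le_rfl⟩ ⟨1, one_pos, one_pos⟩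
      hvac hMGHD,
    bulkCaptureFamily_false_of_mass_zero ⟨0, by norm_num⟩ trivial hMGHD⟩

/-- **`0 < M` is load-bearing, modulo Choquet-Bruhat–Geroch alone** (the cycle-1 kill
`bulkCaptureFamily_false_without_posMass` with both `hLC` and `hvac` discharged). [folklore] -/
theorem bulkCaptureFamily_false_without_posMass' [Kerr.Facts] [Kerr.SliceFacts]
    (hMGHD : choquetBruhat_geroch_exists_mghd_cauchy) :
    ¬ BulkCaptureFamily (Iio 1) (fun _ ↦ True) :=
  bulkCaptureFamily_false_of_mass_zero ⟨0, by norm_num⟩ trivial hMGHD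

end Summit.FinalStateConjecture.FinalStateConjecture.Theorems.BulkKerrCapture.Negative

end
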